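import Summits.RiemannHypothesis.RiemannHypothesis.Theses.EvenThetaVisibilityPinning
import Summits.RiemannHypothesis.RiemannHypothesis.Theorems.GroundBartaPolarPerronFrobeniusEvenSectorPinning
import HarnessLib

/-!
# Route `EvenThetaVisibilityPinning`, item `EvenPinning` (stmt-RiemannHypothesis-19849) — closed

Barta/Temple pinning of an even-sector bottom state against an `L²`-represented even window test:
`|ε_ev(a)| · ‖∫ u h̄‖ ≤ ‖T‖₂`.  This is `PolarPerronFrobenius.evenSector_pinning` (route GroundBarta,
Theorems/GroundBartaPolarPerronFrobeniusEvenSectorPinning.lean: the even-sector weak Euler–Lagrange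
equation `W(gₙ ⋆ h̃) → ε_ev(a)⟨u, h⟩` plus Cauchy–Schwarz `|⟨gₙ, T⟩| ≤ ‖T‖₂`), in the
token-for-token route form `evenPinning_routeForm`.  RH-free.  References: Bombieri 2000 §4 Lemma 1.
-/

set_option linter.dupNamespace false

namespace Summit.RiemannHypothesis.RiemannHypothesis.Theorems.EvenThetaVisibilityPinning

/-- **Item `EvenPinning` (stmt-RiemannHypothesis-19849)**. [cite: Bombieri2000Weil, §4 Lemma 1] -/
theorem evenPinning_proof :
    Summit.RiemannHypothesis.RiemannHypothesis.Theses.EvenThetaVisibilityPinning.EvenPinning :=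
  Summit.RiemannHypothesis.RiemannHypothesis.Theorems.PolarPerronFrobenius.evenPinning_routeForm

end Summit.RiemannHypothesis.RiemannHypothesis.Theorems.EvenThetaVisibilityPinning
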